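import Summits.RiemannHypothesis.RiemannHypothesis.Theorems.MotivicDoorDecreeContinuity
import Summits.RiemannHypothesis.RiemannHypothesis.Theorems.MotivicDoorApproxIdentityKernel
import HarnessLib

/-!
# Motivic door (Connes–Consani): the decree AT the diagonal against a fixed divisor —
# `Δ_E • D(g) → (∫u) N(g)`, `D(g) • Δ_E → (∫u) N(g̃)`, and `(Δ_E + D(g))² → −∞`

Honest framing (cell `pub-rhdoor`, cc-3, verbatim): "lottery ticket at the motivic door; RH
probability negligible; consolation prizes are real: a new semi-local Weil-positivity theorem, or
a located gap in the Connes–Consani programme, plus the ff-door theorem".  VERDICT (ref-1,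
ref-2): `Nonempty ArithmeticWeilSurface` is a restatement of RH in structure clothing.  No RH
content below; value = theorem (RH-free; located-gap item G3′ made quantitative).

Setting (arXiv:1805.10501 §3.1): the decreed pairing `D • D' := N(D ⋆ D̃')` on test divisors,
`𝔰(f, g) = ccPairing f g`; CC's diagonal `Δ` is approached by `Δ_E := toMul u_E`,
`u_E(t) = E u(Et)` (`E = 1 + η` in `MotivicDoorDiagonalDivergence`, where `Δ_E • Δ_E → −∞`).
Here the second divisor is FIXED: `g = toMul w`, `w` a real Weil test, `g̃ = mulReflect g`.

PROVED
* `abs_ccN_toMul_approxConv_sub_le`, `tendsto_ccN_toMul_approxConv`: for the kernel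
  `K_E = v_E ∗ G` of `MotivicDoorApproxIdentityKernel`,
  `|N(toMul K_E) − (∫v) N(toMul G)| ≤ C(R, S, G) · R ‖v‖₁ / (2E)` (`E ≥ 1`) with the explicit
  constant `C = (|M_a| + 4 Σ_{log n < 2a} Λ(n) n^{-1/2} + 4 ∫₁^∞ e^{t/2} dt/(2 sinh t)) sup|G'|
  + 2 sup|G''|`, `a = (R + S + 1)/2` — the window bound `abs_two_mul_ccN_toMul_le` applied to
  `D = K_E − (∫v) G`.
* `ccPairing_toMul_swap_approx_eq`, `ccPairing_toMul_approx_eq`: `𝔰(g, Δ_E) = N(toMul K_E)`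
  with `K_E = (u(−·))_E ∗ w`, and `𝔰(Δ_E, g) = N(toMul K_E)` with `K_E = u_E ∗ w(−·)`.
* `abs_ccPairing_swap_approx_sub_le`, `tendsto_ccPairing_swap_approx(Diagonal)`:
  **`Δ_E • D(g) → (∫u) · N(g)`** with rate `O(1/E)`;
  `abs_ccPairing_approx_sub_le`, `tendsto_ccPairing_approx(Diagonal)`:
  **`D(g) • Δ_E → (∫u) · N(g̃)`** with rate `O(1/E)`.
  Reading: against a fixed divisor the diagonal approximants behave like `(∫u) · Δ` with
  `Δ • D(g) = N(g)` — the distribution `N` itself is the "trace of Frobenius on `D(g)`"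
  (Lefschetz reading of the explicit formula, Connes arXiv:1509.05576 §4.1 eq. (26)–(27)) —
  and ALL divergence of the decree on `span(Δ, test divisors)` sits in the one number `Δ • Δ`.
* `exists_tendsto_ccPairing_approx_ne`: the asymmetry of the decree (`MotivicDoorDecreeAsymmetry`)
  persists at the diagonal: bumps `u = w` in `(0, log 2)` give `D(g) • Δ_E → 0` but
  `Δ_E • D(g) → (∫w) N(g) > 0`.
* `ccPairing_toMul_add_left/right`, `tendsto_ccPairing_approx_add_sub`,
  `tendsto_ccPairing_approxDiagonal_add_atBot`: the decree is bilinear on `toMul` of real Weil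
  tests, `(Δ_E + D(g))² − Δ_E² → (∫u)(N(g̃) + N(g)) + D(g)²`, hence
  **`(Δ_η + D(g)) • (Δ_η + D(g)) → −∞`** for every test divisor `D(g)` (`u ≢ 0`): the
  self-intersection divergence at the diagonal cannot be renormalised away inside the span of
  `Δ` and test divisors.

References: Connes–Consani, arXiv:1805.10501 §3.1, §4; Connes, arXiv:1509.05576 §4.1;
Bombieri 2000, Thm 2 (the explicit formula behind `N`).
-/

noncomputable section

set_option linter.dupNamespace false

open Complex Set MeasureTheory Filter Topology Literature.NumberTheory.LFunctions
open Literature.NumberTheory.ConnesConsani2019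
open scoped Real ComplexConjugate ArithmeticFunction.vonMangoldt

namespace Summit.RiemannHypothesis.RiemannHypothesis.Theorems.MotivicDoor.ConnesConsani

/-! ## 1. `N(toMul K_E) → (∫v) · N(toMul G)` with rate `O(1/E)` -/

section KernelLimit

variable {v G : ℝ → ℝ}

/-- **Explicit rate.**  For real Weil tests `v, G` vanishing off `[−R, R]`, `[−S, S]`,
`|G'| ≤ L₁`, `|G''| ≤ L₂` and `E ≥ 1`:
`|N(toMul K_E) − (∫v) N(toMul G)|
   ≤ ((|M_a| + 4 Σ_{log n<2a} Λ(n) n^{-1/2} + 4 ∫₁^∞ e^{t/2} dt/(2 sinh t)) L₁ + 2 L₂) R ‖v‖₁/(2E)`,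
`a = (R + S + 1)/2`.  PROVED. -/
theorem abs_ccN_toMul_approxConv_sub_le (hv : IsWeilTest fun t ↦ (v t : ℂ))
    (hG : IsWeilTest fun t ↦ (G t : ℂ)) {R S L₁ L₂ : ℝ} (hR : 0 ≤ R) (hS : 0 ≤ S)
    (hvR : ∀ r, R < |r| → v r = 0) (hGS : ∀ x, S < |x| → G x = 0)
    (hL₁ : ∀ t, |deriv G t| ≤ L₁) (hL₂ : ∀ t, |deriv (deriv G) t| ≤ L₂) {E : ℝ} (hE : 1 ≤ E) :
    |ccN (toMul fun t ↦ ∫ s, E * v (E * s) * G (t - s)) - (∫ s, v s) * ccN (toMul G)| ≤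
      ((|weilMarkovConstant ((R + S + 1) / 2)| +
          4 * (∑ n ∈ weilPrimeIndex ((R + S + 1) / 2), (Λ n : ℝ) / Real.sqrt n) +
          4 * ∫ t in Ioi (1 : ℝ), weilArchDensity t) * L₁ + 2 * L₂) * (R * ∫ r, ‖v r‖) /
        (2 * E) := by
  have hE0 : 0 < E := by linarith
  have hvc : Continuous v := (AWS.contDiff_of_isWeilTest hv).continuous
  have hvs : HasCompactSupport v := AWS.hasCompactSupport_of_isWeilTest hv
  have hGcd := AWS.contDiff_of_isWeilTest hG
  have hGd : Differentiable ℝ G := (contDiff_infty_iff_deriv.1 hGcd).1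
  have hGd' : Differentiable ℝ (deriv G) :=
    (contDiff_infty_iff_deriv.1 (contDiff_infty_iff_deriv.1 hGcd).2).1
  have hK := isWeilTest_approxConv hv hG hE0
  have hmG : IsWeilTest fun t ↦ (((∫ s, v s) * G t : ℝ) : ℂ) := by
    simpa only [Complex.ofReal_mul] using hG.const_mul ((∫ s, v s : ℝ) : ℂ)
  have hDW := AWS.isWeilTest_sub_ofReal hK hmG
  have hlin : ccN (toMul fun t ↦ (∫ s, E * v (E * s) * G (t - s)) - (∫ s, v s) * G t) =
      ccN (toMul fun t ↦ ∫ s, E * v (E * s) * G (t - s)) - (∫ s, v s) * ccN (toMul G) := by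
    rw [ccN_toMul_sub hK hmG, ccN_toMul_const_mul]
  have hM₀ : ∀ t, |(∫ s, E * v (E * s) * G (t - s)) - (∫ s, v s) * G t| ≤
      L₁ * R / E * ∫ r, ‖v r‖ := fun t ↦ abs_approxConv_sub_le hvc hvs hvR hGd hL₁ hE0 t
  have hM₁ : ∀ t ∈ Ioc (0 : ℝ) 1, |(∫ s, E * v (E * s) * G (t - s)) - (∫ s, v s) * G t -
      ((∫ s, E * v (E * s) * G (0 - s)) - (∫ s, v s) * G 0)| ≤
      L₂ * R / E * (∫ r, ‖v r‖) * t := fun t ht ↦ by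
    have h := abs_approxConv_sub_sub_le hvc hvs hvR hGd hGd' hL₂ hE0 t 0
    rwa [sub_zero, abs_of_pos ht.1] at h
  have hDa : ∀ t, 2 * ((R + S + 1) / 2) ≤ t →
      (∫ s, E * v (E * s) * G (t - s)) - (∫ s, v s) * G t = 0 := fun t ht ↦ by
    have ht' : R + S < |t| := by rw [abs_of_nonneg (by linarith)]; linarith
    rw [approxConv_eq_zero hvR hGS hE ht', hGS t (by linarith), mul_zero, sub_zero]
  have hmain := abs_two_mul_ccN_toMul_le hDW hDa hM₀ hM₁
  rw [hlin, abs_mul, abs_two] at hmain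
  rw [le_div_iff₀ (by positivity : (0 : ℝ) < 2 * E)]
  calc |ccN (toMul fun t ↦ ∫ s, E * v (E * s) * G (t - s)) - (∫ s, v s) * ccN (toMul G)| *
        (2 * E)
      = E * (2 * |ccN (toMul fun t ↦ ∫ s, E * v (E * s) * G (t - s)) -
          (∫ s, v s) * ccN (toMul G)|) := by ring
    _ ≤ E * ((|weilMarkovConstant ((R + S + 1) / 2)| +
          4 * (∑ n ∈ weilPrimeIndex ((R + S + 1) / 2), (Λ n : ℝ) / Real.sqrt n) +
          4 * ∫ t in Ioi (1 : ℝ), weilArchDensity t) * (L₁ * R / E * ∫ r, ‖v r‖) +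
          2 * (L₂ * R / E * ∫ r, ‖v r‖)) := mul_le_mul_of_nonneg_left hmain hE0.le
    _ = _ := by field_simp

/-- **`N(toMul K_E) → (∫v) N(toMul G)` as `E → ∞`**, for all real Weil tests `v, G`.
PROVED. -/
theorem tendsto_ccN_toMul_approxConv (hv : IsWeilTest fun t ↦ (v t : ℂ))
    (hG : IsWeilTest fun t ↦ (G t : ℂ)) :
    Tendsto (fun E ↦ ccN (toMul fun t ↦ ∫ s, E * v (E * s) * G (t - s))) atTop
      (𝓝 ((∫ s, v s) * ccN (toMul G))) := by
  obtain ⟨R, hR, hvR⟩ := exists_eq_zero_of_lt_abs_of_isWeilTest hv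
  obtain ⟨S, hS, hGS⟩ := exists_eq_zero_of_lt_abs_of_isWeilTest hG
  obtain ⟨L₁, -, hL₁⟩ := AWS.exists_forall_abs_deriv_le_of_isWeilTest hG
  obtain ⟨L₂, hL₂⟩ := exists_forall_abs_deriv_deriv_le_of_isWeilTest hG
  rw [tendsto_iff_norm_sub_tendsto_zero]
  refine squeeze_zero' (Eventually.of_forall fun E ↦ norm_nonneg _)
    ((eventually_ge_atTop (1 : ℝ)).mono fun E hE ↦ ?_)
    (tendsto_const_nhds.div_atTop (tendsto_id.const_mul_atTop two_pos) :
      Tendsto (fun E : ℝ ↦ ((|weilMarkovConstant ((R + S + 1) / 2)| +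
          4 * (∑ n ∈ weilPrimeIndex ((R + S + 1) / 2), (Λ n : ℝ) / Real.sqrt n) +
          4 * ∫ t in Ioi (1 : ℝ), weilArchDensity t) * L₁ + 2 * L₂) * (R * ∫ r, ‖v r‖) /
        (2 * E)) atTop (𝓝 0))
  rw [Real.norm_eq_abs]
  exact abs_ccN_toMul_approxConv_sub_le hv hG hR hS hvR hGS hL₁ hL₂ hE

end KernelLimit

/-! ## 2. `Δ_E • D(g)` and `D(g) • Δ_E` for a fixed test divisor `D(g)` -/

section Diagonal

variable {u w : ℝ → ℝ}

/-- `𝔰(g, Δ_E) = N(toMul K_E)` with `K_E = (u(−·))_E ∗ w` (`g = toMul w`, `Δ_E = toMul u_E`).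
PROVED. -/
theorem ccPairing_toMul_swap_approx_eq (u w : ℝ → ℝ) (E : ℝ) :
    ccPairing (toMul w) (toMul fun t ↦ E * u (E * t)) =
      ccN (toMul fun t ↦ ∫ s, E * u (-(E * s)) * w (t - s)) := by
  rw [ccPairing_toMul_toMul_swap]
  refine congrArg (fun κ ↦ ccN (toMul κ)) (funext fun t ↦ ?_)
  rw [← integral_neg_eq_self (μ := volume) (f := fun s ↦ E * u (-(E * s)) * w (t - s))]
  refine integral_congr_ae (Eventually.of_forall fun s ↦ ?_)
  show E * u (E * s) * w (s - -t) = E * u (-(E * -s)) * w (t - -s)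
  rw [mul_neg, neg_neg, sub_neg_eq_add, sub_neg_eq_add, add_comm]

/-- `𝔰(Δ_E, g) = N(toMul K_E)` with `K_E = u_E ∗ w(−·)`.  PROVED. -/
theorem ccPairing_toMul_approx_eq (u w : ℝ → ℝ) (E : ℝ) :
    ccPairing (toMul fun t ↦ E * u (E * t)) (toMul w) =
      ccN (toMul fun t ↦ ∫ s, E * u (E * s) * w (-(t - s))) := by
  rw [ccPairing_toMul_toMul]
  simp only [neg_sub]

/-- **`Δ_E • D(g)`, explicit rate**: `|𝔰(g, Δ_E) − (∫u) N(g)| ≤ C · R ‖u‖₁ / (2E)` for `E ≥ 1`.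
PROVED. -/
theorem abs_ccPairing_swap_approx_sub_le (hu : IsWeilTest fun t ↦ (u t : ℂ))
    (hw : IsWeilTest fun t ↦ (w t : ℂ)) {R S L₁ L₂ : ℝ} (hR : 0 ≤ R) (hS : 0 ≤ S)
    (huR : ∀ r, R < |r| → u r = 0) (hwS : ∀ x, S < |x| → w x = 0)
    (hL₁ : ∀ t, |deriv w t| ≤ L₁) (hL₂ : ∀ t, |deriv (deriv w) t| ≤ L₂) {E : ℝ} (hE : 1 ≤ E) :
    |ccPairing (toMul w) (toMul fun t ↦ E * u (E * t)) - (∫ s, u s) * ccN (toMul w)| ≤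
      ((|weilMarkovConstant ((R + S + 1) / 2)| +
          4 * (∑ n ∈ weilPrimeIndex ((R + S + 1) / 2), (Λ n : ℝ) / Real.sqrt n) +
          4 * ∫ t in Ioi (1 : ℝ), weilArchDensity t) * L₁ + 2 * L₂) * (R * ∫ r, ‖u r‖) /
        (2 * E) := by
  have h := abs_ccN_toMul_approxConv_sub_le (v := fun x ↦ u (-x)) (G := w) hu.comp_neg hw hR
    hS (fun r hr ↦ huR (-r) (by rwa [abs_neg])) hwS hL₁ hL₂ hE
  rw [integral_neg_eq_self (μ := volume) (f := u),
    integral_neg_eq_self (μ := volume) (f := fun r ↦ ‖u r‖)] at h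
  rwa [ccPairing_toMul_swap_approx_eq]

/-- **`D(g) • Δ_E`, explicit rate**: `|𝔰(Δ_E, g) − (∫u) N(g̃)| ≤ C · R ‖u‖₁ / (2E)`,
`g̃ = mulReflect g`.  PROVED. -/
theorem abs_ccPairing_approx_sub_le (hu : IsWeilTest fun t ↦ (u t : ℂ))
    (hw : IsWeilTest fun t ↦ (w t : ℂ)) {R S L₁ L₂ : ℝ} (hR : 0 ≤ R) (hS : 0 ≤ S)
    (huR : ∀ r, R < |r| → u r = 0) (hwS : ∀ x, S < |x| → w x = 0)
    (hL₁ : ∀ t, |deriv w t| ≤ L₁) (hL₂ : ∀ t, |deriv (deriv w) t| ≤ L₂) {E : ℝ} (hE : 1 ≤ E) :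
    |ccPairing (toMul fun t ↦ E * u (E * t)) (toMul w) -
        (∫ s, u s) * ccN (mulReflect (toMul w))| ≤
      ((|weilMarkovConstant ((R + S + 1) / 2)| +
          4 * (∑ n ∈ weilPrimeIndex ((R + S + 1) / 2), (Λ n : ℝ) / Real.sqrt n) +
          4 * ∫ t in Ioi (1 : ℝ), weilArchDensity t) * L₁ + 2 * L₂) * (R * ∫ r, ‖u r‖) /
        (2 * E) := by
  rw [ccPairing_toMul_approx_eq, ccN_congr fun x hx ↦ mulReflect_toMul w hx]
  exact abs_ccN_toMul_approxConv_sub_le (G := fun x ↦ w (-x)) hu hw.comp_neg hR hS huR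
    (fun x hx ↦ hwS (-x) (by rwa [abs_neg])) (abs_deriv_comp_neg_le hL₁)
    (abs_deriv_deriv_comp_neg_le hL₂) hE

/-- **`Δ_E • D(g) → (∫u) · N(g)`** as `E → ∞`, for all real Weil tests `u, w`.  PROVED. -/
theorem tendsto_ccPairing_swap_approx (hu : IsWeilTest fun t ↦ (u t : ℂ))
    (hw : IsWeilTest fun t ↦ (w t : ℂ)) :
    Tendsto (fun E ↦ ccPairing (toMul w) (toMul fun t ↦ E * u (E * t))) atTop
      (𝓝 ((∫ s, u s) * ccN (toMul w))) := by
  have h := tendsto_ccN_toMul_approxConv (v := fun x ↦ u (-x)) (G := w) hu.comp_neg hw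
  rw [integral_neg_eq_self (μ := volume) (f := u)] at h
  exact h.congr fun E ↦ (ccPairing_toMul_swap_approx_eq u w E).symm

/-- **`D(g) • Δ_E → (∫u) · N(g̃)`** as `E → ∞`.  PROVED. -/
theorem tendsto_ccPairing_approx (hu : IsWeilTest fun t ↦ (u t : ℂ))
    (hw : IsWeilTest fun t ↦ (w t : ℂ)) :
    Tendsto (fun E ↦ ccPairing (toMul fun t ↦ E * u (E * t)) (toMul w)) atTop
      (𝓝 ((∫ s, u s) * ccN (mulReflect (toMul w)))) := by
  have h := tendsto_ccN_toMul_approxConv (v := u) (G := fun x ↦ w (-x)) hu hw.comp_neg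
  rw [← ccN_congr fun x hx ↦ mulReflect_toMul w hx] at h
  exact h.congr fun E ↦ (ccPairing_toMul_approx_eq u w E).symm

/-- The same limit in the tree's `approxDiagonal` parameter `E = 1 + η`, `η → ∞`.  PROVED. -/
theorem tendsto_ccPairing_swap_approxDiagonal (hu : IsWeilTest fun t ↦ (u t : ℂ))
    (hw : IsWeilTest fun t ↦ (w t : ℂ)) :
    Tendsto (fun η : ℝ ↦ ccPairing (toMul w) (toMul fun t ↦ (1 + η) * u ((1 + η) * t)))
      atTop (𝓝 ((∫ s, u s) * ccN (toMul w))) :=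
  (tendsto_ccPairing_swap_approx hu hw).comp (tendsto_atTop_add_const_left _ _ tendsto_id)

/-- The same limit in the parameter `E = 1 + η`.  PROVED. -/
theorem tendsto_ccPairing_approxDiagonal (hu : IsWeilTest fun t ↦ (u t : ℂ))
    (hw : IsWeilTest fun t ↦ (w t : ℂ)) :
    Tendsto (fun η : ℝ ↦ ccPairing (toMul fun t ↦ (1 + η) * u ((1 + η) * t)) (toMul w))
      atTop (𝓝 ((∫ s, u s) * ccN (mulReflect (toMul w)))) :=
  (tendsto_ccPairing_approx hu hw).comp (tendsto_atTop_add_const_left _ _ tendsto_id)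

/-- **The asymmetry persists at the diagonal**: there are real Weil tests `u, w` (a bump in the
window `(0, log 2)`) with `D(g) • Δ_E → 0` but `Δ_E • D(g) → c > 0`.  PROVED. -/
theorem exists_tendsto_ccPairing_approx_ne :
    ∃ u w : ℝ → ℝ, IsWeilTest (fun t ↦ (u t : ℂ)) ∧ IsWeilTest (fun t ↦ (w t : ℂ)) ∧
      Tendsto (fun E ↦ ccPairing (toMul fun t ↦ E * u (E * t)) (toMul w)) atTop (𝓝 0) ∧
      ∃ c, 0 < c ∧
        Tendsto (fun E ↦ ccPairing (toMul w) (toMul fun t ↦ E * u (E * t))) atTop (𝓝 c) := by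
  have hL : 0 < Real.log 2 := Real.log_pos one_lt_two
  set L := Real.log 2 with hLdef
  let b : ContDiffBump (L / 2) := ⟨L / 16, L / 8, by positivity, by linarith⟩
  have hW : IsWeilTest fun t ↦ ((b t : ℝ) : ℂ) :=
    ⟨Complex.ofRealCLM.contDiff.comp b.contDiff,
      b.hasCompactSupport.comp_left Complex.ofReal_zero⟩
  have hzero : ∀ t, L / 8 ≤ |t - L / 2| → b t = 0 := fun t ht ↦
    b.zero_of_le_dist (by rwa [Real.dist_eq])
  have h0 : ∀ t, t ≤ 0 → b t = 0 := fun t ht ↦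
    hzero t (by rw [abs_of_nonpos (by linarith)]; linarith)
  have h2 : ∀ t, Real.log 2 ≤ t → b t = 0 := fun t ht ↦
    hzero t (by rw [abs_of_nonneg (by linarith)]; linarith)
  have hrefl : ccN (mulReflect (toMul b)) = 0 := by
    rw [ccN_congr fun x hx ↦ mulReflect_toMul b hx]
    exact ccN_toMul_eq_zero_of_forall _ fun t ht ↦ h0 (-t) (by linarith)
  have hpos : 0 < (∫ s, b s) * ccN (toMul b) := by
    refine mul_pos b.integral_pos ((massDstar_toMul_pos _ hW (fun t ↦ b.nonneg) (t₀ := L / 2)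
      ?_).trans_le (massDstar_toMul_le_ccN _ hW (fun t ↦ b.nonneg) h0 h2))
    rw [b.one_of_mem_closedBall (Metric.mem_closedBall_self b.rIn_pos.le)]
    exact one_ne_zero
  refine ⟨b, b, hW, hW, ?_, _, hpos, tendsto_ccPairing_swap_approx hW hW⟩
  have h := tendsto_ccPairing_approx hW hW
  rwa [hrefl, mul_zero] at h

end Diagonal

/-! ## 3. Bilinearity and `(Δ_E + D(g))² → −∞` -/

section SelfIntersection

variable {u u₁ u₂ w w₁ w₂ : ℝ → ℝ}

/-- `u_E(t) = E u(Et)` is a Weil test for `E > 0`.  PROVED. -/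
theorem isWeilTest_approxScale (hu : IsWeilTest fun t ↦ (u t : ℂ)) {E : ℝ} (hE : 0 < E) :
    IsWeilTest fun t ↦ ((E * u (E * t) : ℝ) : ℂ) := by
  have h := isWeilTest_approxDiagonal hu (η := E - 1) (by linarith)
  have e : (1 : ℝ) + (E - 1) = E := by ring
  rw [e] at h
  exact h

/-- **The decree is additive in the first `toMul` argument.**  PROVED. -/
theorem ccPairing_toMul_add_left (hu₁ : IsWeilTest fun t ↦ (u₁ t : ℂ))
    (hu₂ : IsWeilTest fun t ↦ (u₂ t : ℂ)) (hw : IsWeilTest fun t ↦ (w t : ℂ)) :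
    ccPairing (toMul fun t ↦ u₁ t + u₂ t) (toMul w) =
      ccPairing (toMul u₁) (toMul w) + ccPairing (toMul u₂) (toMul w) := by
  rw [ccPairing_toMul_toMul, ccPairing_toMul_toMul, ccPairing_toMul_toMul,
    ← ccN_toMul_add (isWeilTest_crossCorr hu₁ hw) (isWeilTest_crossCorr hu₂ hw)]
  refine congrArg (fun κ ↦ ccN (toMul κ)) (funext fun t ↦ ?_)
  have hwc : Continuous w := (AWS.contDiff_of_isWeilTest hw).continuous
  have hi : ∀ {v : ℝ → ℝ}, IsWeilTest (fun t ↦ (v t : ℂ)) →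
      Integrable fun s ↦ v s * w (s - t) := fun hv ↦
    ((AWS.contDiff_of_isWeilTest hv).continuous.mul (by fun_prop)
      : Continuous fun s ↦ _ * w (s - t)).integrable_of_hasCompactSupport
      (AWS.hasCompactSupport_of_isWeilTest hv).mul_right
  rw [← integral_add (hi hu₁) (hi hu₂)]
  exact integral_congr_ae (Eventually.of_forall fun s ↦ add_mul _ _ _)

/-- **The decree is additive in the second `toMul` argument.**  PROVED. -/
theorem ccPairing_toMul_add_right (hu : IsWeilTest fun t ↦ (u t : ℂ))
    (hw₁ : IsWeilTest fun t ↦ (w₁ t : ℂ)) (hw₂ : IsWeilTest fun t ↦ (w₂ t : ℂ)) :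
    ccPairing (toMul u) (toMul fun t ↦ w₁ t + w₂ t) =
      ccPairing (toMul u) (toMul w₁) + ccPairing (toMul u) (toMul w₂) := by
  rw [ccPairing_toMul_toMul, ccPairing_toMul_toMul, ccPairing_toMul_toMul,
    ← ccN_toMul_add (isWeilTest_crossCorr hu hw₁) (isWeilTest_crossCorr hu hw₂)]
  refine congrArg (fun κ ↦ ccN (toMul κ)) (funext fun t ↦ ?_)
  have huc : Continuous u := (AWS.contDiff_of_isWeilTest hu).continuous
  have hus : HasCompactSupport u := AWS.hasCompactSupport_of_isWeilTest hu
  have hi : ∀ {v : ℝ → ℝ}, IsWeilTest (fun t ↦ (v t : ℂ)) →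
      Integrable fun s ↦ u s * v (s - t) := fun hv ↦
    ((huc.mul ((AWS.contDiff_of_isWeilTest hv).continuous.comp (by fun_prop)))
      : Continuous fun s ↦ u s * _).integrable_of_hasCompactSupport hus.mul_right
  rw [← integral_add (hi hw₁) (hi hw₂)]
  exact integral_congr_ae (Eventually.of_forall fun s ↦ mul_add _ _ _)

/-- **`(Δ_E + D(g))² − Δ_E² → (∫u)(N(g̃) + N(g)) + D(g)²`** as `E → ∞`.  PROVED. -/
theorem tendsto_ccPairing_approx_add_sub (hu : IsWeilTest fun t ↦ (u t : ℂ))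
    (hw : IsWeilTest fun t ↦ (w t : ℂ)) :
    Tendsto (fun E ↦ ccPairing (toMul fun t ↦ E * u (E * t) + w t)
        (toMul fun t ↦ E * u (E * t) + w t) -
      ccPairing (toMul fun t ↦ E * u (E * t)) (toMul fun t ↦ E * u (E * t))) atTop
      (𝓝 ((∫ s, u s) * (ccN (mulReflect (toMul w)) + ccN (toMul w)) +
        ccPairing (toMul w) (toMul w))) := by
  have hlim := ((tendsto_ccPairing_approx hu hw).add (tendsto_ccPairing_swap_approx hu hw)).add
    (tendsto_const_nhds (x := ccPairing (toMul w) (toMul w)))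
  rw [show (∫ s, u s) * (ccN (mulReflect (toMul w)) + ccN (toMul w)) +
      ccPairing (toMul w) (toMul w) = (∫ s, u s) * ccN (mulReflect (toMul w)) +
      (∫ s, u s) * ccN (toMul w) + ccPairing (toMul w) (toMul w) by ring]
  refine hlim.congr' ((eventually_gt_atTop (0 : ℝ)).mono fun E hE ↦ ?_)
  have hE' := isWeilTest_approxScale hu hE
  have hsum : IsWeilTest fun t ↦ ((E * u (E * t) + w t : ℝ) : ℂ) := by
    convert hE'.add hw using 1
    funext t
    simp only [Pi.add_apply, Complex.ofReal_add]
  show _ = _ - _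
  rw [ccPairing_toMul_add_left hE' hw hsum, ccPairing_toMul_add_right hE' hE' hw,
    ccPairing_toMul_add_right hw hE' hw]
  ring

/-- **`(Δ_η + D(g)) • (Δ_η + D(g)) → −∞`** for every test divisor `D(g)`, `g = toMul w`, and every
real test `u ≢ 0` (with `Δ_η • Δ_η → −∞` from `MotivicDoorDiagonalDivergence`).  PROVED. -/
theorem tendsto_ccPairing_approxDiagonal_add_atBot (hu : IsWeilTest fun t ↦ (u t : ℂ))
    (hw : IsWeilTest fun t ↦ (w t : ℂ)) {R : ℝ} (hR : 0 < R)
    (hsupp : tsupport (fun t ↦ (u t : ℂ)) ⊆ Icc (-R) R) (hpos : 0 < ∫ t, ‖(u t : ℂ)‖ ^ 2) :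
    Tendsto (fun η : ℝ ↦ ccPairing (toMul fun t ↦ (1 + η) * u ((1 + η) * t) + w t)
      (toMul fun t ↦ (1 + η) * u ((1 + η) * t) + w t)) atTop atBot := by
  have h1 := tendsto_ccPairing_approxDiagonal_atBot hu hR hsupp hpos
  have h2 : Tendsto (fun η : ℝ ↦ ccPairing (toMul fun t ↦ (1 + η) * u ((1 + η) * t) + w t)
        (toMul fun t ↦ (1 + η) * u ((1 + η) * t) + w t) -
      ccPairing (toMul fun t ↦ (1 + η) * u ((1 + η) * t))
        (toMul fun t ↦ (1 + η) * u ((1 + η) * t))) atTop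
      (𝓝 ((∫ s, u s) * (ccN (mulReflect (toMul w)) + ccN (toMul w)) +
        ccPairing (toMul w) (toMul w))) :=
    (tendsto_ccPairing_approx_add_sub hu hw).comp (tendsto_atTop_add_const_left _ _ tendsto_id)
  exact (h1.atBot_add h2).congr fun η ↦ by ring

end SelfIntersection

end Summit.RiemannHypothesis.RiemannHypothesis.Theorems.MotivicDoor.ConnesConsani
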